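import Mathlib
import Summits.NavierStokesRegularity.NavierStokesRegularity.Theorems.DssFarFieldSlavingBlowupTypeIDssProfileSimilarityEnstrophyTimeOnlyThreshold
import Literature.Analysis.FluidPDE.PineauVicolEnstrophyIdentity
import HarnessLib

/-!
# T33 endpoint: the GENERALISED-BELTRAMI Liouville theorem for KNSS-gauge Type-I ancient mild fields,
  THRESHOLD-FREE — `curl (ω × V) ≡ 0 ⇒ V ≡ 0` at every Type-I level (pub-ns-dss theory
  EXPLICIT-THRESHOLDS row T33 / empty cell E25, DERIVED on paper, here a tree theorem; route
  `DssFarFieldSlaving`, crux `BlowupTypeIDssProfile`, stmt-NavierStokesRegularity-0155 — SUPPORT;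
  typer seat g17, 2026-08-26)

HONEST FRAMING. An exclusion statement about a HYPOTHETICAL object (a Type-I ancient mild solution in
the Koch–Nadirashvili–Seregin–Šverák gauge, `IsTypeIAncientMild C V`, ANY constant `C`) under the
generalised-Beltrami hypothesis `curl (curl V(t) × V(t)) = 0` for every `t < 0` (the Lamb vector is a
gradient; the vorticity equation loses its nonlinearity): THEN `V ≡ 0`. It discharges the hypothesis
`h` of the conditional wrapper `ExplicitThreshold.rdssClass_generalisedBeltrami_empty` (E25 at class
level, previously CONDITIONAL). No threshold; nothing numeric; census words on ACCEPT, if any, are the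
lead's; nothing here bears on Navier–Stokes regularity or blow-up.

PROOF (the cut-off similarity-enstrophy method of files `…CutoffBudget` / `…TimeOnlyThreshold`, with
the stretching term now HARMLESS). By `curl (W × Ω) = DW(Ω) − (div W)Ω + (div Ω)W − DΩ(W)`
(`curl_cross_apply`) with `div V = div ω = 0`, the hypothesis says `Dω(V) = DV(ω)` pointwise; by the
KNSS scaling the same holds for the similarity pair `(U, Ω)`: `DU(Ω) = DΩ(U)`. Hence in the tree's
identity `signedBudget_deriv_cutoffEnstrophy_eq` the stretching `2∫φ_R⟪DU Ω, Ω⟫ = 2∫φ_R⟪(U·∇)Ω, Ω⟫`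
is a pure transport term and CANCELS the transport flux `∫(U·∇φ_R)‖Ω‖²` exactly
(`two_mul_integral_mul_inner_convect_self_eq_of_isDivFree`): `Z_R' = −½Z_R + ½∫(y·∇φ_R)‖Ω‖² +
∫‖Ω‖²Δφ_R − 2∫φ_R‖∇Ω‖²_F ≤ −½Z_R + (c₂/R)∫_{B̄_{2R}}‖Ω‖²`. The a-priori-bound/bootstrap/monotonicity
argument of `…TimeOnlyThreshold` (restated here for a general rate `κ > 0`) gives `Z ≡ 0`, `Ω ≡ 0`,
and the curl-free/div-free/bounded endgame gives `V ≡ 0`.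
-/

noncomputable section

set_option linter.dupNamespace false

namespace Summit.NavierStokesRegularity.NavierStokesRegularity.Theorems.SimilarityEnstrophy

open MeasureTheory Set Filter Topology Metric InnerProductSpace Function Real
open scoped RealInnerProductSpace Laplacian ContDiff
open Literature.Analysis Literature.Analysis.FluidPDE
open Summit.NavierStokesRegularity.NavierStokesRegularity.Theorems
open Summit.NavierStokesRegularity.NavierStokesRegularity.Theorems.GaussianGap
open Summit.NavierStokesRegularity.NavierStokesRegularity.Theorems.BlobRiccatiClosure.TypeIApexLiouville

variable {C : ℝ} {V : ℝ → EuclideanSpace ℝ (Fin 3) → EuclideanSpace ℝ (Fin 3)}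

/-! ### The bootstrap at a general rate -/

/-- **The cut-off enstrophy vanishes under any budget `Z_R' ≤ −κZ_R + (L/R)∫_{B̄_{2R}}‖Ω‖²`** with
`κ > 0`, `L ≥ 0`, for a KNSS-gauge Type-I field (the argument of `cutoffEnstrophy_eq_zero_of_lt_one`
at a general rate: a priori `Z_ρ ≤ aρ³` uniformly in `s`, four bootstrap steps, `R → ∞` through
monotonicity in `R`). [this file] -/
theorem cutoffEnstrophy_eq_zero_of_budget (hV : IsTypeIAncientMild C V) {κ L : ℝ} (hκ : 0 < κ)
    (hL : 0 ≤ L)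
    (hbudget : ∀ R : ℝ, 1 ≤ R → ∀ s : ℝ,
      deriv (fun σ => ∫ y, smoothTransition (2 - ‖y‖ ^ 2 / R ^ 2) * ‖lerayVorticity V σ y‖ ^ 2) s ≤
        -κ * (∫ y, smoothTransition (2 - ‖y‖ ^ 2 / R ^ 2) * ‖lerayVorticity V s y‖ ^ 2) +
          L / R * ∫ y in closedBall (0 : EuclideanSpace ℝ (Fin 3)) (2 * R),
            ‖lerayVorticity V s y‖ ^ 2) :
    ∀ R : ℝ, 1 ≤ R → ∀ s : ℝ,
      (∫ y, smoothTransition (2 - ‖y‖ ^ 2 / R ^ 2) * ‖lerayVorticity V s y‖ ^ 2) = 0 := by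
  -- the a priori cubic bound, uniformly in `s`
  obtain ⟨K₁, hK₁⟩ := typeIGauge_exists_pow_mul_norm_iteratedFDeriv_le C 1
  have hΩb : ∀ s y, ‖lerayVorticity V s y‖ ≤ ‖curlCLM‖ * K₁ := fun s y => by
    refine (norm_curl_le (lerayOrbit V s) y).trans
      (mul_le_mul_of_nonneg_left ?_ (norm_nonneg curlCLM))
    rw [← norm_iteratedFDeriv_one]
    exact norm_iteratedFDeriv_lerayOrbit_le hV hK₁ s y
  set v₁ : ℝ := (volume : Measure (EuclideanSpace ℝ (Fin 3))).real
    (closedBall (0 : EuclideanSpace ℝ (Fin 3)) 1) with hv₁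
  have hv₁0 : 0 ≤ v₁ := measureReal_nonneg
  set a : ℝ := (‖curlCLM‖ * K₁) ^ 2 * (8 * v₁) with ha
  have ha0 : 0 ≤ a := by positivity
  have hB0 : ∀ ρ : ℝ, 1 ≤ ρ → ∀ s : ℝ,
      (∫ y, smoothTransition (2 - ‖y‖ ^ 2 / ρ ^ 2) * ‖lerayVorticity V s y‖ ^ 2) ≤ a * ρ ^ 3 := by
    intro ρ hρ1 s
    have hρ : 0 < ρ := lt_of_lt_of_le one_pos hρ1
    calc (∫ y, smoothTransition (2 - ‖y‖ ^ 2 / ρ ^ 2) * ‖lerayVorticity V s y‖ ^ 2)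
        ≤ ∫ y in closedBall (0 : EuclideanSpace ℝ (Fin 3)) (2 * ρ), ‖lerayVorticity V s y‖ ^ 2 :=
          cutoffEnstrophy_le_setIntegral hV hρ s
      _ ≤ (‖curlCLM‖ * K₁) ^ 2 * ((2 * ρ) ^ 3 * v₁) := setIntegral_closedBall_le_of_bound hV hΩb hρ s
      _ = a * ρ ^ 3 := by rw [ha]; ring
  -- four bootstrap steps
  set b : ℝ := L / κ with hb
  have hb0 : 0 ≤ b := div_nonneg hL hκ.le
  have hstep := fun (B : ℝ → ℝ) hB => cutoffEnstrophy_bootstrap_step hV hκ hL hbudget (B := B) hB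
  have hB1 : ∀ R : ℝ, 1 ≤ R → ∀ s : ℝ,
      (∫ y, smoothTransition (2 - ‖y‖ ^ 2 / R ^ 2) * ‖lerayVorticity V s y‖ ^ 2) ≤ 8 * a * b * R ^ 2 := by
    intro R hR1 s
    have hR : 0 < R := lt_of_lt_of_le one_pos hR1
    refine (hstep (fun ρ => a * ρ ^ 3) hB0 R hR1 s).trans (le_of_eq ?_)
    rw [hb]; field_simp; ring
  have hB2 : ∀ R : ℝ, 1 ≤ R → ∀ s : ℝ,
      (∫ y, smoothTransition (2 - ‖y‖ ^ 2 / R ^ 2) * ‖lerayVorticity V s y‖ ^ 2) ≤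
        32 * a * b ^ 2 * R := by
    intro R hR1 s
    have hR : 0 < R := lt_of_lt_of_le one_pos hR1
    refine (hstep (fun ρ => 8 * a * b * ρ ^ 2) hB1 R hR1 s).trans (le_of_eq ?_)
    rw [hb]; field_simp; ring
  have hB3 : ∀ R : ℝ, 1 ≤ R → ∀ s : ℝ,
      (∫ y, smoothTransition (2 - ‖y‖ ^ 2 / R ^ 2) * ‖lerayVorticity V s y‖ ^ 2) ≤
        64 * a * b ^ 3 := by
    intro R hR1 s
    have hR : 0 < R := lt_of_lt_of_le one_pos hR1
    refine (hstep (fun ρ => 32 * a * b ^ 2 * ρ) hB2 R hR1 s).trans (le_of_eq ?_)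
    rw [hb]; field_simp; ring
  have hB4 : ∀ R : ℝ, 1 ≤ R → ∀ s : ℝ,
      (∫ y, smoothTransition (2 - ‖y‖ ^ 2 / R ^ 2) * ‖lerayVorticity V s y‖ ^ 2) ≤
        64 * a * b ^ 4 / R := by
    intro R hR1 s
    have hR : 0 < R := lt_of_lt_of_le one_pos hR1
    refine (hstep (fun _ => 64 * a * b ^ 3) hB3 R hR1 s).trans (le_of_eq ?_)
    rw [hb]; field_simp
  -- `R → ∞` through monotonicity in `R`
  intro R₀ hR₀1 s
  have hR₀ : 0 < R₀ := lt_of_lt_of_le one_pos hR₀1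
  have hle : ∀ R : ℝ, R₀ ≤ R →
      (∫ y, smoothTransition (2 - ‖y‖ ^ 2 / R₀ ^ 2) * ‖lerayVorticity V s y‖ ^ 2) ≤
        64 * a * b ^ 4 / R := fun R hR =>
    (cutoffEnstrophy_mono hV hR₀ hR s).trans (hB4 R (hR₀1.trans hR) s)
  have hlim : Tendsto (fun R : ℝ => 64 * a * b ^ 4 / R) atTop (𝓝 0) :=
    tendsto_const_nhds.div_atTop tendsto_id
  have hZle : (∫ y, smoothTransition (2 - ‖y‖ ^ 2 / R₀ ^ 2) * ‖lerayVorticity V s y‖ ^ 2) ≤ 0 :=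
    ge_of_tendsto hlim (eventually_atTop.2 ⟨R₀, fun R hR => hle R hR⟩)
  exact le_antisymm hZle (cutoffEnstrophy_nonneg V R₀ s)

/-- **From a vanishing cut-off enstrophy to the vanishing of the field** (the endgame of
`…TimeOnlyThreshold`, general form): if `Z_R(s) = 0` for all `R ≥ 1`, `s`, then `V ≡ 0` on `t < 0`
(`φ_R = 1` on `B̄_R`, continuity, `curl V ≡ 0`, `eq_of_curl_eq_zero_of_isDivFree_of_bounded`,
`IsTypeIAncientMild.eq_zero_of_slice_const`). [this file] -/
theorem eq_zero_of_cutoffEnstrophy_eq_zero (hV : IsTypeIAncientMild C V)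
    (hZ : ∀ R : ℝ, 1 ≤ R → ∀ s : ℝ,
      (∫ y, smoothTransition (2 - ‖y‖ ^ 2 / R ^ 2) * ‖lerayVorticity V s y‖ ^ 2) = 0) :
    ∀ t < 0, ∀ x, V t x = 0 := by
  have hΩ0 : ∀ s y, lerayVorticity V s y = 0 := by
    intro s y
    set R : ℝ := max 1 ‖y‖ with hRdef
    have hR1 : 1 ≤ R := le_max_left _ _
    have hR : 0 < R := lt_of_lt_of_le one_pos hR1
    have hcΩ : Continuous (lerayVorticity V s) :=
      (signedBudget_contDiff_lerayVorticity_slice hV s (n := 1)).continuous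
    have hc : Continuous fun z : EuclideanSpace ℝ (Fin 3) =>
        smoothTransition (2 - ‖z‖ ^ 2 / R ^ 2) * ‖lerayVorticity V s z‖ ^ 2 :=
      (contDiff_smoothTransition_cutoff (n := 1) R).continuous.mul (hcΩ.norm.pow 2)
    have hint : Integrable fun z : EuclideanSpace ℝ (Fin 3) =>
        smoothTransition (2 - ‖z‖ ^ 2 / R ^ 2) * ‖lerayVorticity V s z‖ ^ 2 :=
      hc.integrable_of_hasCompactSupport ((hasCompactSupport_smoothTransition_cutoff hR).mul_right)
    have hae : (fun z : EuclideanSpace ℝ (Fin 3) =>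
        smoothTransition (2 - ‖z‖ ^ 2 / R ^ 2) * ‖lerayVorticity V s z‖ ^ 2) =ᵐ[volume] 0 :=
      (integral_eq_zero_iff_of_nonneg (fun z => mul_nonneg (smoothTransition_cutoff_nonneg R z)
        (sq_nonneg _)) hint).1 (hZ R hR1 s)
    have hev : (fun z : EuclideanSpace ℝ (Fin 3) =>
        smoothTransition (2 - ‖z‖ ^ 2 / R ^ 2) * ‖lerayVorticity V s z‖ ^ 2) = fun _ => (0 : ℝ) :=
      (hc.ae_eq_iff_eq (μ := volume) continuous_const).1 hae
    have hy := congrFun hev y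
    rw [smoothTransition_cutoff_eq_one hR (le_max_right _ _), one_mul] at hy
    exact norm_eq_zero.1 (pow_eq_zero_iff (n := 2) (by norm_num) |>.1 hy)
  have hcurl : ∀ t < 0, ∀ x, curl (V t) x = 0 := by
    intro t ht x
    set s : ℝ := -Real.log (-t) with hs
    have hts : -Real.exp (-s) = t := by
      rw [hs, neg_neg, Real.exp_log (neg_pos.2 ht), neg_neg]
    have h := hΩ0 s ((Real.exp (-s / 2))⁻¹ • x)
    rw [lerayVorticity_apply, curl_lerayOrbit, smul_smul,
      mul_inv_cancel₀ (Real.exp_pos _).ne', one_smul, hts, smul_eq_zero] at h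
    exact h.resolve_left (Real.exp_pos _).ne'
  have hconst : ∀ t < 0, ∀ x, V t x = V t 0 := fun t ht x =>
    eq_of_curl_eq_zero_of_isDivFree_of_bounded ((hV.contDiff_slice ht).of_le (by norm_cast))
      (hcurl t ht) (hV.isDivFree ht) (fun z => hV.norm_le ht z) x 0
  exact fun t ht x => hV.eq_zero_of_slice_const (b := fun t => V t 0) hconst ht x

/-! ### The generalised-Beltrami identity in similarity variables -/

/-- **`curl (ω × V) = 0` means `Dω(V) = DV(ω)`** for divergence-free `V` (and `ω = curl V`, also
divergence free): `curl (W × Ω) = DW(Ω) − (div W)Ω + (div Ω)W − DΩ(W)` (`curl_cross_apply`).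
[folklore] -/
theorem fderiv_curl_apply_eq_of_beltrami (hV : IsTypeIAncientMild C V)
    (hbel : ∀ t < 0, ∀ x, curl (fun y => cross (curl (V t) y) (V t y)) x = 0)
    {t : ℝ} (ht : t < 0) (x : EuclideanSpace ℝ (Fin 3)) :
    fderiv ℝ (curl (V t)) x (V t x) = fderiv ℝ (V t) x (curl (V t) x) := by
  have hV3 : ContDiff ℝ 3 (V t) := (hV.contDiff_slice ht).of_le (by norm_cast)
  have hω : ContDiff ℝ 2 (curl (V t)) := contDiff_curl hV3
  have hdω : DifferentiableAt ℝ (curl (V t)) x := (hω.differentiable (by norm_num)) x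
  have hdV : DifferentiableAt ℝ (V t) x := (hV3.differentiable (by norm_num)) x
  have h := hbel t ht x
  rw [curl_cross_apply hdω hdV, hV.isDivFree ht x,
    divergence_curl_eq_zero_holds _ (hV3.of_le (by norm_cast)) x, zero_smul, zero_smul,
    sub_zero, add_zero, sub_eq_zero] at h
  exact h

/-- **The same identity for the similarity pair**: `DΩ(s,y)(U(s,y)) = DU(s,y)(Ω(s,y))` for
`U = lerayOrbit V`, `Ω = lerayVorticity V` (both sides scale with `e^{−2s}`). [folklore] -/
theorem fderiv_lerayVorticity_apply_eq_of_beltrami (hV : IsTypeIAncientMild C V)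
    (hbel : ∀ t < 0, ∀ x, curl (fun y => cross (curl (V t) y) (V t y)) x = 0)
    (s : ℝ) (y : EuclideanSpace ℝ (Fin 3)) :
    fderiv ℝ (lerayVorticity V s) y (lerayOrbit V s y) =
      fderiv ℝ (lerayOrbit V s) y (lerayVorticity V s y) := by
  set c : ℝ := Real.exp (-s / 2) with hc
  set t : ℝ := -Real.exp (-s) with htdef
  have ht : t < 0 := neg_neg_of_pos (Real.exp_pos _)
  have hU : lerayOrbit V s = fun z => c • V t (c • z) := by funext z; rw [lerayOrbit_apply]
  have hΩ : lerayVorticity V s = curl fun z => c • V t (c • z) := by rw [lerayVorticity_apply, hU]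
  rw [hΩ, hU, fderiv_curl_smul_comp_smul, fderiv_smul_comp_smul, curl_const_smul_comp_smul]
  simp only [FunLike.coe_smul, Pi.smul_apply, map_smul, smul_smul]
  rw [fderiv_curl_apply_eq_of_beltrami hV hbel ht (c • y)]
  ring_nf

/-! ### The budget under the Beltrami hypothesis and T33 -/

/-- **The localised similarity-enstrophy inequality under the generalised-Beltrami hypothesis,
THRESHOLD-FREE**: there is `L ≥ 0` with `Z_R' ≤ −½Z_R + (L/R)∫_{B̄_{2R}}‖Ω‖²` for every `R ≥ 1`,
`s` — the stretching equals the transport term `2∫φ_R⟪(U·∇)Ω, Ω⟫ = −∫(U·∇φ_R)‖Ω‖²`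
(`two_mul_integral_mul_inner_convect_self_eq_of_isDivFree`) and cancels the transport flux in the
tree's identity `signedBudget_deriv_cutoffEnstrophy_eq`; the drift flux is `≤ 0`; the viscous flux
is `≤ (c₂/R²)∫_{B̄_{2R}}‖Ω‖²`. [this file] -/
theorem deriv_cutoffEnstrophy_le_of_beltrami (hV : IsTypeIAncientMild C V)
    (hbel : ∀ t < 0, ∀ x, curl (fun y => cross (curl (V t) y) (V t y)) x = 0) :
    ∃ L : ℝ, 0 ≤ L ∧ ∀ R : ℝ, 1 ≤ R → ∀ s : ℝ,
      deriv (fun σ => ∫ y, smoothTransition (2 - ‖y‖ ^ 2 / R ^ 2) * ‖lerayVorticity V σ y‖ ^ 2) s ≤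
        -(1 / 2) * (∫ y, smoothTransition (2 - ‖y‖ ^ 2 / R ^ 2) * ‖lerayVorticity V s y‖ ^ 2) +
          L / R * ∫ y in closedBall (0 : EuclideanSpace ℝ (Fin 3)) (2 * R),
            ‖lerayVorticity V s y‖ ^ 2 := by
  obtain ⟨c₂, hc₂0, hc₂⟩ :=
    exists_abs_laplacian_smoothTransition_cutoff_le (E := EuclideanSpace ℝ (Fin 3))
  refine ⟨c₂, hc₂0, fun R hR1 s => ?_⟩
  have hR : 0 < R := lt_of_lt_of_le one_pos hR1
  rw [signedBudget_deriv_cutoffEnstrophy_eq hV hR s]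
  set φ : EuclideanSpace ℝ (Fin 3) → ℝ := fun z => smoothTransition (2 - ‖z‖ ^ 2 / R ^ 2)
    with hφdef
  set Ω := lerayVorticity V s with hΩdef
  set U := lerayOrbit V s with hUdef
  set I : ℝ := ∫ y in closedBall (0 : EuclideanSpace ℝ (Fin 3)) (2 * R), ‖Ω y‖ ^ 2 with hIdef
  have hI0 : 0 ≤ I := integral_nonneg fun y => sq_nonneg _
  have hφ : ContDiff ℝ ∞ φ := contDiff_smoothTransition_cutoff (n := ⊤) R
  have hφ2 : ContDiff ℝ 2 φ := contDiff_smoothTransition_cutoff (n := 2) R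
  have hφc : HasCompactSupport φ := hasCompactSupport_smoothTransition_cutoff hR
  have hΩs : ContDiff ℝ ∞ Ω := signedBudget_contDiff_lerayVorticity_slice hV s (n := ⊤)
  have hUs : ContDiff ℝ ∞ U := mustSqueeze_contDiff_lerayOrbit_slice hV s (n := ⊤)
  have hcΩ : Continuous Ω := hΩs.continuous
  have hdivU : VectorCalculus.IsDivFree U :=
    (isDivFree_lerayOrbit_iff V s).2 (hV.isDivFree (neg_neg_of_pos (Real.exp_pos _)))
  -- (1) drift flux `≤ 0`
  have hD : (∫ y, fderiv ℝ φ y y * ‖Ω y‖ ^ 2) ≤ 0 := signedBudget_drift_flux_nonpos V R s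
  -- (2) the stretching IS the transport term and cancels the transport flux
  have hP : 2 * (∫ y, φ y * ⟪fderiv ℝ U y (Ω y), Ω y⟫) = -(∫ y, fderiv ℝ φ y (U y) * ‖Ω y‖ ^ 2) := by
    have h := two_mul_integral_mul_inner_convect_self_eq_of_isDivFree (φ := φ) (W := Ω) (V := U)
      hφ hφc hΩs hUs hdivU
    rw [← h]
    congr 1
    refine integral_congr_ae (Eventually.of_forall fun y => ?_)
    show φ y * ⟪fderiv ℝ U y (Ω y), Ω y⟫ = φ y * ⟪convect U Ω y, Ω y⟫
    rw [convect_apply, ← fderiv_lerayVorticity_apply_eq_of_beltrami hV hbel s y]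
  -- (3) viscous flux
  have hVisc : |∫ y, ‖Ω y‖ ^ 2 * (Δ φ) y| ≤ (c₂ / R ^ 2) * I := by
    refine abs_integral_le_of_weight_sq hcΩ (w := fun y => |(Δ φ) y|)
      (continuous_laplacian hφ2).abs (fun y hy => ?_) (fun y _ => hc₂ R hR y) (fun y => ?_)
    · show |(Δ φ) y| = 0
      rw [hφdef, signedBudget_laplacian_cutoff_eq_zero hR hy, abs_zero]
    · rw [abs_mul, abs_of_nonneg (sq_nonneg ‖Ω y‖), mul_comm]
  have hR2 : c₂ / R ^ 2 ≤ c₂ / R := by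
    rw [div_le_div_iff₀ (by positivity) hR]
    have : R ≤ R ^ 2 := by nlinarith
    exact mul_le_mul_of_nonneg_left this hc₂0
  have hVisc' := ((le_abs_self _).trans hVisc).trans (mul_le_mul_of_nonneg_right hR2 hI0)
  have hF : 0 ≤ ∫ y, φ y * frobeniusNormSq (fderiv ℝ Ω y) :=
    integral_nonneg fun y => mul_nonneg (smoothTransition_cutoff_nonneg R y) (frobeniusNormSq_nonneg _)
  linarith

/-- **T33 (generalised-Beltrami endpoint), CLASSICAL, THRESHOLD-FREE.** A Type-I ancient mild solution
in the KNSS gauge (`IsTypeIAncientMild C V`, ANY `C`) whose Lamb vector is curl-free at every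
negative time, `curl (curl V(t) × V(t)) ≡ 0`, vanishes identically on `t < 0`: cut-off enstrophy
budget `Z_R' ≤ −½Z_R + (L/R)∫_{B̄_{2R}}‖Ω‖²` (`deriv_cutoffEnstrophy_le_of_beltrami`), bootstrap
(`cutoffEnstrophy_eq_zero_of_budget`), endgame (`eq_zero_of_cutoffEnstrophy_eq_zero`). This is the
hypothesis `h` of `ExplicitThreshold.rdssClass_generalisedBeltrami_empty`. [this file; theory
EXPLICIT-THRESHOLDS row T33 (DERIVED on paper by vorticity Duhamel; here by the localised enstrophy);
nothing here bears on NS regularity] -/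
theorem typeI_ancient_eq_zero_of_generalisedBeltrami (hV : IsTypeIAncientMild C V)
    (hbel : ∀ t < 0, ∀ x, curl (fun y => cross (curl (V t) y) (V t y)) x = 0) :
    ∀ t < 0, ∀ x, V t x = 0 := by
  obtain ⟨L, hL, hbudget⟩ := deriv_cutoffEnstrophy_le_of_beltrami hV hbel
  have hbudget' : ∀ R : ℝ, 1 ≤ R → ∀ s : ℝ,
      deriv (fun σ => ∫ y, smoothTransition (2 - ‖y‖ ^ 2 / R ^ 2) * ‖lerayVorticity V σ y‖ ^ 2) s ≤
        -(1 / 2 : ℝ) * (∫ y, smoothTransition (2 - ‖y‖ ^ 2 / R ^ 2) * ‖lerayVorticity V s y‖ ^ 2) +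
          L / R * ∫ y in closedBall (0 : EuclideanSpace ℝ (Fin 3)) (2 * R),
            ‖lerayVorticity V s y‖ ^ 2 := hbudget
  exact eq_zero_of_cutoffEnstrophy_eq_zero hV
    (cutoffEnstrophy_eq_zero_of_budget hV (κ := 1 / 2) one_half_pos hL hbudget')

/-- **T33 in the shape of the hypothesis `h` of `ExplicitThreshold.rdssClass_generalisedBeltrami_empty`**,
verbatim. [this file] -/
theorem generalisedBeltrami_hypothesis :
    ∀ ⦃C : ℝ⦄ ⦃V : ℝ → EuclideanSpace ℝ (Fin 3) → EuclideanSpace ℝ (Fin 3)⦄,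
      IsTypeIAncientMild C V →
      (∀ t < 0, ∀ x, curl (fun y => cross (curl (V t) y) (V t y)) x = 0) →
      ∀ t < 0, ∀ x, V t x = 0 :=
  fun _ _ hV hbel => typeI_ancient_eq_zero_of_generalisedBeltrami hV hbel

/-- **E25 at CLASS level, UNCONDITIONAL and THRESHOLD-FREE** (the conditional wrapper
`ExplicitThreshold.rdssClass_generalisedBeltrami_empty` with its hypothesis `h` discharged by T33):
for every Type-I constant `M`, NO member of the hypothesis class of `RdssProfileTruncation` (any factor
`c > 1`, any twist `R ∈ O(3)`) has all its smooth KNSS-gauge Type-I representatives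
generalised-Beltrami (`curl (curl V(t) × V(t)) ≡ 0`). DSS-BLIND. Census words on ACCEPT, if any, are
the lead's. [this file; nothing numerical is asserted and nothing here bears on NS regularity] -/
theorem rdssClass_generalisedBeltrami_empty_unconditional (M : ℝ) :
    ¬ ∃ (c : ℝ) (R : (EuclideanSpace ℝ (Fin 3)) ≃ₗᵢ[ℝ] (EuclideanSpace ℝ (Fin 3)))
        (u : ℝ → (EuclideanSpace ℝ (Fin 3)) → (EuclideanSpace ℝ (Fin 3))),
      1 < c ∧ IsAncientMildSolution 1 u ∧ (∀ t < 0, AEStronglyMeasurable (u t) volume) ∧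
      IsRotatedDSS c R u ∧ HasTypeIDecay M u ∧
      (∀ V : ℝ → EuclideanSpace ℝ (Fin 3) → EuclideanSpace ℝ (Fin 3), IsTypeIAncientMild M V →
        (∀ t < 0, V t =ᵐ[volume] u t) →
        ∀ t < 0, ∀ x, curl (fun y => cross (curl (V t) y) (V t y)) x = 0) ∧
      ¬ (∀ t < 0, u t =ᵐ[volume] 0) :=
  ExplicitThreshold.rdssClass_generalisedBeltrami_empty generalisedBeltrami_hypothesis M

end Summit.NavierStokesRegularity.NavierStokesRegularity.Theorems.SimilarityEnstrophy

end
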